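import Literature.NumberTheory.DiophantineApproximation.PolylogHermitePade
import HarnessLib

/-!
# Every-weight Hermite–Padé forms at rational points `x = M/N` — vocabulary

Topic `Literature/NumberTheory/DiophantineApproximation`. The rational-point version of the
coefficients of `PolylogHermitePade.lean`: for partial-fraction data `c` of the weight-`w` kernel
(`PolylogPade.kernelW`, expanded by `PolylogPade.exists_pf_kernelW`) and `x = M/N`,

  `M^n S^{(w)}_n(M/N) = ∑_{o<w} a^ℚ_o Li_{o+1}(M/N) + a^ℚ`

with `a^ℚ_o = coefWQ n c N M o = ∑_{p≤n} c_{o,p} N^p M^{n−p}` and the constant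
`constWQ n w c N M = −∑_{o<w} ∑_{p≤n} c_{o,p} ∑_{1≤m≤p} N^p M^{n−p} M^m/(N^m m^{o+1})`
(from `∑_{u≥0} x^{u+1}/(u+p+1)^s = x^{−p}(Li_s(x) − ∑_{m≤p} x^m/m^s)` and `M^n x^{−p} = N^p M^{n−p}`).
At `M = 1` these are `coefW`, `constW`. Definitions only; identity, integrality (`d_n^w`) and sizes
are proved in the sibling files, and the independence of `1, Li₁(M/N), …, Li_w(M/N)` for
`log N ≥ (w+1)³ + 2w log M` in `PolylogLinearIndependenceRational.lean`. (The exponent `n − p` is a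
natural-number subtraction with `p ≤ n` inside the sum.)

References: E. M. Nikišin, Mat. Sb. 109 (1979); M. Hata, J. Math. Pures Appl. 69 (1990);
S. David, N. Hirata-Kohno, M. Kawashima, Moscow J. Comb. Number Th. 9 (2020), Thm 2.1.
-/

noncomputable section

open Finset

namespace Literature.NumberTheory.DiophantineApproximation

namespace PolylogPade

/-- The coefficient of `Li_{o+1}(M/N)` in `M^n S^{(w)}_n(M/N)`: `∑_{p ≤ n} c_{o,p} N^p M^{n−p}`.
[cite: DavidHirataKohnoKawashima2020, Thm 2.1] -/
def coefWQ (n : ℕ) (c : ℕ → ℕ → ℚ) (N M o : ℕ) : ℚ :=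
  ∑ p ∈ range (n + 1), c o p * (N : ℚ) ^ p * (M : ℚ) ^ (n - p)

/-- The constant term of `M^n S^{(w)}_n(M/N)`:
`−∑_{o<w} ∑_{p≤n} c_{o,p} ∑_{1 ≤ m ≤ p} N^p M^{n−p} M^m/(N^m m^{o+1})`.
[cite: DavidHirataKohnoKawashima2020, Thm 2.1] -/
def constWQ (n w : ℕ) (c : ℕ → ℕ → ℚ) (N M : ℕ) : ℚ :=
  -∑ o ∈ range w, ∑ p ∈ range (n + 1),
    c o p * ∑ m ∈ Icc 1 p,
      (N : ℚ) ^ p * (M : ℚ) ^ (n - p) * ((M : ℚ) ^ m / ((N : ℚ) ^ m * (m : ℚ) ^ (o + 1)))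

/-- At `M = 1` the rational-point coefficient is `coefW`. [folklore] -/
theorem coefWQ_one (n : ℕ) (c : ℕ → ℕ → ℚ) (N o : ℕ) : coefWQ n c N 1 o = coefW n c N o := by
  simp [coefWQ, coefW]

/-- At `M = 1` the rational-point constant term is `constW`. [folklore] -/
theorem constWQ_one (n w : ℕ) (c : ℕ → ℕ → ℚ) (N : ℕ) : constWQ n w c N 1 = constW n w c N := by
  unfold constWQ constW
  congr 1
  refine sum_congr rfl fun o _ => sum_congr rfl fun p _ => ?_
  congr 1
  refine sum_congr rfl fun m _ => ?_
  simp only [Nat.cast_one, one_pow, mul_one]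
  ring

end PolylogPade

end Literature.NumberTheory.DiophantineApproximation
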